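import Literature.AlgebraicGeometry.Motives.AffineLineBundleDominant
import Literature.AlgebraicGeometry.Limits.SubalgebraDiagram
import Literature.AlgebraicGeometry.Motives.SubschemeCyclesPushPullProofs
import Literature.AlgebraicGeometry.Motives.CyclesPushforwardProofs
import Literature.AlgebraicGeometry.Motives.SubschemeCyclesFlatPullbackProofs
import HarnessLib

/-!
# `A_k(𝔸ⁿ) = 0` for `k < n` (Fulton, *Intersection Theory*, §1.9, Prop. 1.9)

Fulton, §1.9 (p. 22–23, read in the held copy), Prop. 1.9: for an affine bundle `p : E → X` of
rank `n` the flat pull-back `p^* : A_k X → A_{k+n} E` is surjective; "In particular, `A_k(𝔸ⁿ)` is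
zero for `k < n`." This file proves, on the tree's carriers (`Motives/Cycles`: `cyclesOfDim`,
`ratTrivial`, `ChowGroup`; flat pull-back `flatPullback` of `Motives/SubschemeCycles`), for a
field `k` and a `k`-scheme `T` of finite type, with `p : 𝔸¹ ×ₖ T → T`
(`Motives/AffineLineProduct`):

* `exists_primeCycle_sub_flatPullback_mem_ratTrivial_of_height_eq` — the dominant case of the
  printed proof over the closure `W` of the image ("We may replace `X` by the closure of `p(V)`
  (cf. Proposition 1.7)"): `Motives/AffineLineBundleDominant` over the subvariety `W`, pushed
  forward along `𝔸¹ × W ↪ 𝔸¹ × T` (Fulton Thm. 1.4 = `map_mem_ratTrivial_holds`, and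
  `p^*` commutes with the push-forward, Fulton Prop. 1.7 = `pushforward_flatPullback_holds`, the
  base-change square being `Limits.SubalgApprox.isPullback_whiskerLeft_left`);
* `primeCycle_mem_ratTrivial_succ`, `cyclesOfDim_succ_le_ratTrivial` — **`Z_d(T) ≤ Rat_d(T)`
  implies `Z_{d+1}(𝔸¹ ×ₖ T) ≤ Rat_{d+1}`** (the two cases `dim p(V) = d`: `[V] = p^*[p(V)]`, and
  `dim p(V) = d + 1`: the dominant case; then Fulton Thm. 1.7,
  `flatPullback_mem_ratTrivial_of_finiteType_holds`, `p` flat of relative dimension `1`);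
  `cyclesOfDim_zero_le_ratTrivial` — `Z_0(𝔸¹ ×ₖ T) ≤ Rat_0`;
* `affinePower k n = 𝔸¹ ×ₖ (𝔸¹ ×ₖ (⋯ ×ₖ Spec k))` — affine `n`-space as an iterated product, and
  **`cyclesOfDim_affinePower_le_ratTrivial`: `Z_j(𝔸ⁿ) ≤ Rat_j(𝔸ⁿ)` for `j < n`**, i.e.
  `A_j(𝔸ⁿ_k) = 0` (`chowGroup_affinePower_subsingleton`), by induction on `n`.

Everything is proved; the local-finiteness facts enter as the explicit hypotheses `hf`, `hZ`
(tree convention; both are discharged in the tree). What is NOT here: the identification of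
`affinePower k n` with `Spec k[x₁, …, xₙ]` and with the standard charts of `ℙⁿ`, and
`A_n(𝔸ⁿ) = ℤ`; `A_k(ℙⁿ)` (Fulton, Example 1.9.3) is the sequel.

## References

* [Fulton1998] W. Fulton, *Intersection Theory*, 2nd ed. (1998), §1.9, Prop. 1.9 and its proof
  (pp. 22–23), Thm. 1.4, Thm. 1.7, Prop. 1.7.
* [StacksProject] The Stacks Project, Tag 02JW (dimension formula).
-/

noncomputable section

open CategoryTheory CategoryTheory.Limits AlgebraicGeometry Order MonoidalCategory Polynomial

universe u

namespace Literature.AlgebraicGeometry.Motives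

/-! ### Push-forward of cycles: subtraction and supports -/

section MapLemmas

variable {X Y : Scheme.{u}} (f : X ⟶ Y) [QuasiCompact f]

/-- Push-forward of cycles (dimension weights) is compatible with subtraction (a special case of
`algebraicCycleMap_sub` of `Motives/AlgebraicEquivalencePushforwardFacts`, kept private here to
avoid that import). [folklore] -/
private theorem algebraicCycleMap_sub_height (a b : AlgebraicCycle X ℤ) :
    AlgebraicCycle.map f height height (a - b) =
      AlgebraicCycle.map f height height a - AlgebraicCycle.map f height height b := by
  refine eq_sub_of_add_eq ?_
  rw [← algebraicCycleMap_add, sub_add_cancel]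

/-- A point of the push-forward `f_* c` is the image of a point of `c` of the same dimension.
[folklore] -/
theorem exists_of_algebraicCycleMap_ne_zero {c : AlgebraicCycle X ℤ} {y : Y}
    (hy : AlgebraicCycle.map f height height c y ≠ 0) :
    ∃ x, f.base x = y ∧ c x ≠ 0 ∧ height x = height y := by
  simp only [AlgebraicCycle.map, Function.locallyFinsupp.map_apply] at hy
  obtain ⟨x, hx, hx'⟩ := exists_ne_zero_of_finsum_mem_ne_zero hy
  have hcx : c x ≠ 0 := fun h ↦ hx' (by simp [h])
  have hw : height x = height (f.base x) := by
    by_contra h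
    exact hx' (by simp [AlgebraicCycle.mapCoeff, h])
  rw [Set.mem_preimage, Set.mem_singleton_iff] at hx
  exact ⟨x, hx, hcx, hx ▸ hw⟩

end MapLemmas

namespace AffineLineProduct

/-! ### Replacing the base by the closure of the image (Fulton, Prop. 1.9: "We may replace `X`
by the closure of `p(V)` (cf. Proposition 1.7)") -/

section ReplaceBase

variable {k : Type u} [Field k] {T : SchemeOver k}

/-- The closed immersion `closure {w} ↪ T` over `k`. [folklore] -/
abbrev baseι (w : ↥T.left) : baseOfPoint (k := k) w ⟶ T :=
  Over.homMk (ClosedSubvariety.ofPoint T.left w).ι rfl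

/-- The closed immersion `𝔸¹ ×ₖ closure {w} ↪ 𝔸¹ ×ₖ T` over `k`. [folklore] -/
abbrev totalι (w : ↥T.left) : 𝔸₁ k ⊗ baseOfPoint (k := k) w ⟶ 𝔸₁ k ⊗ T :=
  𝔸₁ k ◁ baseι w

/-- `closure {w} ↪ T` is a closed immersion. [folklore] -/
instance (w : ↥T.left) : IsClosedImmersion (baseι (k := k) w).left :=
  inferInstanceAs (IsClosedImmersion (ClosedSubvariety.ofPoint T.left w).ι)

/-- `𝔸¹ ×ₖ closure {w} ↪ 𝔸¹ ×ₖ T` is a closed immersion (base change). [folklore] -/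
instance (w : ↥T.left) : IsClosedImmersion (totalι (k := k) w).left :=
  MorphismProperty.of_isPullback (P := @IsClosedImmersion)
    (Literature.AlgebraicGeometry.Limits.SubalgApprox.isPullback_whiskerLeft_left (𝔸₁ k)
      (baseι w)).flip inferInstance

/-- The generic point of `closure {w}` maps to `w`. [folklore] -/
theorem baseι_genericPoint (w : ↥T.left) :
    (baseι (k := k) w).left.base (genericPoint _) = w :=
  ClosedSubvariety.genericPoint_ofPoint w

/-- `dim closure {w} = height w`. [folklore] -/
theorem height_genericPoint_baseOfPoint (w : ↥T.left) :
    height (genericPoint ↥(baseOfPoint (k := k) w).left) = height w := by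
  rw [← height_base_eq_of_isClosedImmersion' (baseι (k := k) w).left (genericPoint _),
    baseι_genericPoint]

variable [LocallyOfFiniteType T.hom]

/-- `closure {w} → Spec k` is locally of finite type. [folklore] -/
instance (w : ↥T.left) : LocallyOfFiniteType (baseOfPoint (k := k) w).hom :=
  inferInstanceAs (LocallyOfFiniteType ((ClosedSubvariety.ofPoint T.left w).ι ≫ T.hom))

/-- `𝔸¹ ×ₖ T → Spec k` is locally of finite type. [folklore] -/
instance locallyOfFiniteType_total_hom : LocallyOfFiniteType (𝔸₁ k ⊗ T).hom :=
  inferInstanceAs (LocallyOfFiniteType (pullback.fst (𝔸₁ k).hom T.hom ≫ (𝔸₁ k).hom))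

variable [QuasiCompact T.hom]

/-- `closure {w} → Spec k` is quasi-compact. [folklore] -/
instance (w : ↥T.left) : QuasiCompact (baseOfPoint (k := k) w).hom :=
  inferInstanceAs (QuasiCompact ((ClosedSubvariety.ofPoint T.left w).ι ≫ T.hom))

/-- `𝔸¹ ×ₖ T → Spec k` is quasi-compact. [folklore] -/
instance quasiCompact_total_hom : QuasiCompact (𝔸₁ k ⊗ T).hom :=
  inferInstanceAs (QuasiCompact (pullback.fst (𝔸₁ k).hom T.hom ≫ (𝔸₁ k).hom))

/-- **Fulton, Prop. 1.9, the dominant case over the closure of the image.** For `T` of finite type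
over `k` and a point `v` of `𝔸¹ ×ₖ T` with `dim closure {v} = dim closure {p v} = j` (i.e.
`V = closure {v}` maps generically finitely onto `W = closure {p v}`), there is a cycle `w₁` on
`T`, supported on points of dimension `j - 1`, with `[V] - p^* w₁ ∈ Rat_j(𝔸¹ ×ₖ T)`: apply
`exists_primeCycle_sub_flatPullback_mem_ratTrivial` over the subvariety `W` ("We may replace `X`
by the closure of `p(V)`") and push the relation forward along `𝔸¹ × W ↪ 𝔸¹ × T` (proper
push-forward preserves rational equivalence, Fulton Thm. 1.4 = the tree's
`map_mem_ratTrivial_holds`, and commutes with `p^*`, Fulton Prop. 1.7 = the tree's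
`pushforward_flatPullback_holds`). [cite: Fulton1998, Prop. 1.9 (proof)] -/
theorem exists_primeCycle_sub_flatPullback_mem_ratTrivial_of_height_eq
    (hf : locallyFinsupp_flatPullbackFun.{u}) (hZ : locallyFinsupp_fundamentalCycleFun.{u})
    {j : ℕ} {v : ↥(𝔸₁ k ⊗ T).left} (hv : height v = j)
    (hw : height ((proj k T).left.base v) = j) :
    ∃ w₁ : AlgebraicCycle T.left ℤ, (∀ y, w₁ y ≠ 0 → height y + 1 = (j : ℕ∞)) ∧
      primeCycle v - flatPullback (proj k T).left hf w₁ ∈ ratTrivial (𝔸₁ k ⊗ T).left j := by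
  set w := (proj k T).left.base v with hwdef
  have hTW : height (genericPoint ↥(baseOfPoint (k := k) w).left) = j := by
    rw [height_genericPoint_baseOfPoint, hw]
  -- the point `v'` of `𝔸¹ × W` over the generic point of `W` mapping to `v`
  have H := Literature.AlgebraicGeometry.Limits.SubalgApprox.isPullback_whiskerLeft_left (𝔸₁ k) (baseι (k := k) w)
  obtain ⟨v', hv'η, hv'v⟩ := Scheme.exists_preimage_of_isPullback H.flip
    (genericPoint ↥(baseOfPoint (k := k) w).left) v (by rw [baseι_genericPoint]; rfl)
  have hv'h : height v' = j := by
    rw [← height_base_eq_of_isClosedImmersion' (totalι (k := k) w).left v', hv'v, hv]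
  -- Fulton's dominant case over `W`
  obtain ⟨w', hw'pts, hrat⟩ := exists_primeCycle_sub_flatPullback_mem_ratTrivial
    (T := baseOfPoint (k := k) w) hf hZ hTW hv'η hv'h
  -- push forward along `𝔸¹ × W ↪ 𝔸¹ × T`
  have hpush := map_mem_ratTrivial_holds j (totalι (k := k) w) hrat
  rw [algebraicCycleMap_sub_height, algebraicCycleMap_primeCycle, hv'v,
    ← pushforward_flatPullback_holds (baseι (k := k) w) (proj k T) (totalι (k := k) w)
      (proj k (baseOfPoint (k := k) w)) H.flip hf isEquidimensional_proj isEquidimensional_proj w']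
    at hpush
  refine ⟨AlgebraicCycle.map (baseι (k := k) w).left height height w', ?_, hpush⟩
  intro y hy
  obtain ⟨y', hy'y, hy', hh⟩ := exists_of_algebraicCycleMap_ne_zero _ hy
  rw [← hh]
  exact hw'pts y' hy'

end ReplaceBase

end AffineLineProduct

/-! ### From prime cycles to all cycles -/

/-- On a compact scheme, `Z_d ≤ Rat_d` as soon as every prime `d`-cycle is in `Rat_d` (cycles are
finite sums of prime cycles). [cite: Fulton1998, §1.3] -/
theorem cyclesOfDim_le_ratTrivial_of_primeCycle {X : Scheme.{u}} [CompactSpace ↥X] {d : ℕ}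
    (h : ∀ z : ↥X, height z = d → primeCycle z ∈ ratTrivial X d) :
    cyclesOfDim X d ≤ ratTrivial X d := by
  intro c hc
  have hsupp : Function.support c ⊆ ((finite_support_of_compactSpace c).toFinset : Set ↥X) := by
    intro z hz
    rw [Finset.mem_coe, Set.Finite.mem_toFinset]
    exact hz
  rw [eq_sum_smul_primeCycle_of_support_subset c hsupp]
  refine AddSubgroup.sum_mem _ fun z hz ↦ AddSubgroup.zsmul_mem _ (h z (hc z ?_)) _
  rw [Set.Finite.mem_toFinset] at hz
  exact hz

namespace AffineLineProduct

/-! ### `Z_{d+1}(𝔸¹ ×ₖ T) ≤ Rat` from `Z_d(T) ≤ Rat`, and `Z_0(𝔸¹ ×ₖ T) ≤ Rat` (Fulton, Prop. 1.9) -/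

section Surjectivity

variable {k : Type u} [Field k] {T : SchemeOver k} [LocallyOfFiniteType T.hom]

/-- `dim closure {p v} ≤ dim closure {v}`. [cite: StacksProject, Tag 02JW] -/
theorem height_base_le (v : ↥(𝔸₁ k ⊗ T).left) : height ((proj k T).left.base v) ≤ height v := by
  rw [height_eq_height_base_add v]
  exact le_self_add

variable [QuasiCompact T.hom]

/-- **`A_0(𝔸¹ ×ₖ T)`: every closed point of `𝔸¹ ×ₖ T` is rationally equivalent to zero** (the case
`dim X = k + 1 = 0` of Fulton's argument: no components `Wᵢ` of negative dimension).
[cite: Fulton1998, Prop. 1.9 (proof)] -/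
theorem primeCycle_mem_ratTrivial_zero (hf : locallyFinsupp_flatPullbackFun.{u})
    (hZ : locallyFinsupp_fundamentalCycleFun.{u}) {v : ↥(𝔸₁ k ⊗ T).left} (hv : height v = 0) :
    primeCycle v ∈ ratTrivial (𝔸₁ k ⊗ T).left 0 := by
  have hw : height ((proj k T).left.base v) = ((0 : ℕ) : ℕ∞) :=
    le_antisymm (by rw [Nat.cast_zero, ← hv]; exact height_base_le v) bot_le
  obtain ⟨w₁, hw₁, hrat⟩ := exists_primeCycle_sub_flatPullback_mem_ratTrivial_of_height_eq hf hZ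
    (j := 0) (by rw [hv, Nat.cast_zero]) hw
  have hw₁0 : w₁ = 0 := by
    ext y
    by_contra h
    have h' := hw₁ y h
    rw [Nat.cast_zero] at h'
    exact absurd h' (by simp)
  rw [hw₁0, map_zero, sub_zero] at hrat
  exact hrat

/-- **Fulton, Prop. 1.9 (surjectivity of `p^*` modulo rational equivalence), in the form used for
`A_k(𝔸ⁿ) = 0`**: if every `d`-cycle on `T` is rationally equivalent to zero, then so is every
`(d+1)`-cycle `[V]` on `𝔸¹ ×ₖ T` — either `dim p(V) = d` and `[V] = p^*[p(V)]`
(`primeCycle_eq_flatPullback_of_height_eq`), or `dim p(V) = d + 1` and `[V] - p^* w₁ ∈ Rat` with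
`w₁` a `d`-cycle on `T` (`exists_primeCycle_sub_flatPullback_mem_ratTrivial_of_height_eq`); in both
cases Fulton's Thm. 1.7 (`flatPullback_mem_ratTrivial_of_finiteType_holds`, `p` flat of relative
dimension `1`) concludes. [cite: Fulton1998, Prop. 1.9 (proof)] -/
theorem primeCycle_mem_ratTrivial_succ (hf : locallyFinsupp_flatPullbackFun.{u})
    (hZ : locallyFinsupp_fundamentalCycleFun.{u}) {d : ℕ}
    (hT : cyclesOfDim T.left d ≤ ratTrivial T.left d) {v : ↥(𝔸₁ k ⊗ T).left}
    (hv : height v = ((d + 1 : ℕ) : ℕ∞)) :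
    primeCycle v ∈ ratTrivial (𝔸₁ k ⊗ T).left (d + 1) := by
  haveI : IsLocallyNoetherian T.left := LocallyOfFiniteType.isLocallyNoetherian T.hom
  have h1 := height_base_le (k := k) v
  have h2 := height_le_height_base_add_one (k := k) v
  rw [hv] at h1 h2
  have hfin : height ((proj k T).left.base v) ≠ ⊤ := ne_top_of_le_ne_top (WithTop.coe_ne_top) h1
  obtain ⟨m, hm⟩ := ENat.ne_top_iff_exists.mp hfin
  rw [← hm] at h1 h2
  have h1' : m ≤ d + 1 := by exact_mod_cast h1
  have h2' : d + 1 ≤ m + 1 := by exact_mod_cast h2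
  rcases Nat.eq_or_lt_of_le h1' with hmeq | hmlt
  · -- dominant case: `dim p(V) = d + 1`
    obtain ⟨w₁, hw₁, hrat⟩ := exists_primeCycle_sub_flatPullback_mem_ratTrivial_of_height_eq hf hZ
      hv (by rw [← hm, hmeq])
    have hw₁d : w₁ ∈ cyclesOfDim T.left d := by
      intro y hy
      have h := hw₁ y hy
      have hyfin : height y ≠ ⊤ := by
        intro htop
        rw [htop, top_add] at h
        exact WithTop.top_ne_coe h
      obtain ⟨a, ha⟩ := ENat.ne_top_iff_exists.mp hyfin
      rw [← ha] at h ⊢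
      have h' : a + 1 = d + 1 := by exact_mod_cast h
      have : a = d := by omega
      rw [this]
    have hp := flatPullback_mem_ratTrivial_of_finiteType_holds (proj k T) hf isEquidimensional_proj
      (hT hw₁d)
    have h := add_mem hrat hp
    rwa [sub_add_cancel] at h
  · -- pull-back case: `dim p(V) = d`
    have hmd : m = d := by omega
    subst hmd
    rw [primeCycle_eq_flatPullback_of_height_eq hf hZ hm.symm (by rw [hv]; push_cast; rfl)]
    exact flatPullback_mem_ratTrivial_of_finiteType_holds (proj k T) hf isEquidimensional_proj
      (hT (primeCycle_mem_cyclesOfDim hm.symm))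

/-- `𝔸¹ ×ₖ T` is compact for `T` of finite type. [folklore] -/
instance compactSpace_total : CompactSpace ↥(𝔸₁ k ⊗ T).left :=
  QuasiCompact.compactSpace_of_compactSpace (𝔸₁ k ⊗ T).hom

/-- **`Z_0(𝔸¹ ×ₖ T) ≤ Rat_0`.** [cite: Fulton1998, Prop. 1.9 (proof)] -/
theorem cyclesOfDim_zero_le_ratTrivial (hf : locallyFinsupp_flatPullbackFun.{u})
    (hZ : locallyFinsupp_fundamentalCycleFun.{u}) :
    cyclesOfDim (𝔸₁ k ⊗ T).left 0 ≤ ratTrivial (𝔸₁ k ⊗ T).left 0 :=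
  cyclesOfDim_le_ratTrivial_of_primeCycle fun _ hz ↦
    primeCycle_mem_ratTrivial_zero hf hZ (by rw [hz, Nat.cast_zero])

/-- **`Z_d(T) ≤ Rat_d(T) ⇒ Z_{d+1}(𝔸¹ ×ₖ T) ≤ Rat_{d+1}`** (Fulton, Prop. 1.9: `p^*` is
surjective modulo rational equivalence). [cite: Fulton1998, Prop. 1.9] -/
theorem cyclesOfDim_succ_le_ratTrivial (hf : locallyFinsupp_flatPullbackFun.{u})
    (hZ : locallyFinsupp_fundamentalCycleFun.{u}) {d : ℕ}
    (hT : cyclesOfDim T.left d ≤ ratTrivial T.left d) :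
    cyclesOfDim (𝔸₁ k ⊗ T).left (d + 1) ≤ ratTrivial (𝔸₁ k ⊗ T).left (d + 1) :=
  cyclesOfDim_le_ratTrivial_of_primeCycle fun _ hz ↦ primeCycle_mem_ratTrivial_succ hf hZ hT hz

end Surjectivity

/-! ### `A_k(𝔸ⁿ) = 0` for `k < n` -/

section AffineSpace

variable (k : Type u) [Field k]

/-- **Affine `n`-space over `k` as the iterated product `𝔸¹ ×ₖ (𝔸¹ ×ₖ (⋯ ×ₖ Spec k))`.**
[folklore] -/
def affinePower : ℕ → SchemeOver k
  | 0 => 𝟙_ (SchemeOver k)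
  | n + 1 => 𝔸₁ k ⊗ affinePower n

/-- `𝔸ⁿ_k → Spec k` is locally of finite type. [folklore] -/
instance locallyOfFiniteType_affinePower : ∀ n, LocallyOfFiniteType (affinePower k n).hom
  | 0 => inferInstanceAs (LocallyOfFiniteType (𝟙 (Spec (CommRingCat.of k))))
  | n + 1 =>
    haveI := locallyOfFiniteType_affinePower n
    inferInstanceAs (LocallyOfFiniteType (𝔸₁ k ⊗ affinePower k n).hom)

/-- `𝔸ⁿ_k → Spec k` is quasi-compact. [folklore] -/
instance quasiCompact_affinePower : ∀ n, QuasiCompact (affinePower k n).hom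
  | 0 => inferInstanceAs (QuasiCompact (𝟙 (Spec (CommRingCat.of k))))
  | n + 1 =>
    haveI := quasiCompact_affinePower n
    haveI := locallyOfFiniteType_affinePower k n
    inferInstanceAs (QuasiCompact (𝔸₁ k ⊗ affinePower k n).hom)

/-- **Fulton, *Intersection Theory*, §1.9, p. 23: "In particular, `A_k(𝔸ⁿ)` is zero for
`k < n`"** — on the iterated-product model `affinePower k n` of `𝔸ⁿ_k` over any field `k`: every
`j`-cycle, `j < n`, is rationally equivalent to zero (`Z_j(𝔸ⁿ) = Rat_j(𝔸ⁿ)`). By induction on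
`n` through `cyclesOfDim_zero_le_ratTrivial` and `cyclesOfDim_succ_le_ratTrivial`.
[cite: Fulton1998, §1.9 (p. 23) and Prop. 1.9] -/
theorem cyclesOfDim_affinePower_le_ratTrivial (hf : locallyFinsupp_flatPullbackFun.{u})
    (hZ : locallyFinsupp_fundamentalCycleFun.{u}) :
    ∀ (n j : ℕ), j < n →
      cyclesOfDim (affinePower k n).left j ≤ ratTrivial (affinePower k n).left j
  | 0, _, hj => absurd hj (Nat.not_lt_zero _)
  | n + 1, 0, _ => cyclesOfDim_zero_le_ratTrivial (T := affinePower k n) hf hZ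
  | n + 1, j + 1, hj => cyclesOfDim_succ_le_ratTrivial (T := affinePower k n) hf hZ
      (cyclesOfDim_affinePower_le_ratTrivial hf hZ n j (by omega))

/-- **`A_j(𝔸ⁿ_k) = 0` for `j < n`**: the Chow group of `j`-cycles of (the iterated-product model
of) affine `n`-space vanishes below the top dimension. [cite: Fulton1998, §1.9 (p. 23)] -/
theorem chowGroup_affinePower_subsingleton (hf : locallyFinsupp_flatPullbackFun.{u})
    (hZ : locallyFinsupp_fundamentalCycleFun.{u}) {n j : ℕ} (hj : j < n) :
    Subsingleton (ChowGroup (affinePower k n).left j) := by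
  refine ⟨fun a b ↦ ?_⟩
  induction a using ChowGroup.induction_on with
  | h c =>
    induction b using ChowGroup.induction_on with
    | h c' =>
      refine ChowGroup.mk_eq_mk_iff.mpr ?_
      exact cyclesOfDim_affinePower_le_ratTrivial k hf hZ n j hj (sub_mem c.2 c'.2)

/-- **`A_j(𝔸ⁿ_k) = 0` for `j < n`, unconditionally** (the local-finiteness facts are discharged in
the tree: `locallyFinsupp_flatPullbackFun_holds`, `locallyFinsupp_fundamentalCycleFun_holds`):
every `j`-cycle on `affinePower k n`, `j < n`, is rationally equivalent to zero.
[cite: Fulton1998, §1.9 (p. 23)] -/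
theorem cyclesOfDim_affinePower_le_ratTrivial' {n j : ℕ} (hj : j < n) :
    cyclesOfDim (affinePower k n).left j ≤ ratTrivial (affinePower k n).left j :=
  cyclesOfDim_affinePower_le_ratTrivial k locallyFinsupp_flatPullbackFun_holds
    locallyFinsupp_fundamentalCycleFun_holds n j hj

/-- **`CH_j(𝔸ⁿ_k) = 0` for `j < n`, unconditionally.** [cite: Fulton1998, §1.9 (p. 23)] -/
theorem chowGroup_affinePower_subsingleton' {n j : ℕ} (hj : j < n) :
    Subsingleton (ChowGroup (affinePower k n).left j) :=
  chowGroup_affinePower_subsingleton k locallyFinsupp_flatPullbackFun_holds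
    locallyFinsupp_fundamentalCycleFun_holds hj

end AffineSpace

end AffineLineProduct

end Literature.AlgebraicGeometry.Motives

end
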